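import Mathlib.Analysis.SpecialFunctions.BinaryEntropy
import Literature.Analysis.SpecialFunctions.LogChooseStirling
import Summits.HubbardSuperconductivity.HubbardSuperconductivity.Theorems.ThermalWedgeTwSeededEnsembleEquivalenceSectorWeightBasics

/-!
# Crux `TwSeededEnsembleEquivalenceR` (stmt-HubbardSuperconductivity-15581), line `cold-floor-collapse`
# (slug `Sketch`), lead c5 — the SHARP sector entropy in the probabilistic normal form of the defect

Support file (`--supports stmt-HubbardSuperconductivity-15581`; sorry-free; no definition; route-file free).

The thermal closer of the tree (`stub_thermalCloser`, `stub_sectorWeightBasics` (d)) spends the WHOLE Fock-space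
entropy `L² log 4` on the canonical/grand-canonical defect: `β(E_V − μN) + log Re Z ≤ L² log 4 + log (Re Z / W_L(N))`.
The particle-number sector `N = 2n` only has `dim = C(2L², N)` states, so the honest entropy is
`log C(2L², N) ≤ 2L²·h(N/(2L²))` (`h` = `Real.binEntropy`, nats), which at the crux's `N_L = 2⌊(1−δ)L²/2⌋`,
`δ ∈ [1/10, 2/5]`, is `≤ 2L²·h((1−δ)/2) < L² log 4` with the slack `c_δ := log 4 − 2h((1−δ)/2) > 0`
(card `floating-floor-budget`, lever (S): "pure domination with the TRUE entropy count"). This file proves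

* `finrank_nParticleSubmodule_le_choose` — `dim (N-particle sector of Fock ι) ≤ C(|ι|, N)`;
* `sharp_defect_normalForm` — (d♯) `β(E_V − μ·2n) + log Re Z ≤ log C(2L², 2n) + log (Re Z / W_L(2n))`;
* `log_choose_le_mul_binEntropy` — `log C(m, k) ≤ m · h(k/m)`;
* `log_choose_sector_le` — `log C(2L², 2⌊(1−δ)L²/2⌋) ≤ 2L² · h((1−δ)/2)` for `0 ≤ δ ≤ 1`;
* `entropySlack_pos` — `0 < log 4 − 2 h((1−δ)/2)` for `0 < δ ≤ 1`.

[folklore: Bratteli–Robinson II §5.3.1 (sector traces); Cover–Thomas (binomial entropy bound)]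
-/

set_option linter.dupNamespace false

namespace Summit.HubbardSuperconductivity.HubbardSuperconductivity.Theorems.TwSeededEnsembleEquivalenceR.HotWindow

open Matrix Finset Literature.MathematicalPhysics.QuantumLattice
open Summit.HubbardSuperconductivity.HubbardSuperconductivity.Theorems.TwSeededEnsembleEquivalence.ThermalDuality
open Summit.HubbardSuperconductivity.HubbardSuperconductivity.Theorems.TwSeededEnsembleEquivalence.ExposedDensity
open scoped ComplexOrder Matrix.Norms.L2Operator

noncomputable section

/-! ### The dimension of a particle-number sector -/

/-- **The `N`-particle sector of the fermionic Fock space over `ι` has dimension at most `C(|ι|, N)`**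
(it is spanned by the occupation-basis vectors `|s⟩`, `|s| = N`). [folklore] -/
theorem finrank_nParticleSubmodule_le_choose {ι : Type*} [LinearOrder ι] [Fintype ι] (N : ℕ) :
    Module.finrank ℂ (nParticleSubmodule (ι := ι) N) ≤ (Fintype.card ι).choose N := by
  classical
  set S : Finset (Fock ι) :=
    ((Finset.univ : Finset ι).powersetCard N).image fun s => Pi.single s (1 : ℂ) with hS
  have hle : (nParticleSubmodule (ι := ι) N) ≤ Submodule.span ℂ (S : Set (Fock ι)) := by
    intro ψ hψ
    have hψ' : IsNParticle N ψ := hψ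
    have hdecomp : ψ = ∑ s ∈ (Finset.univ : Finset ι).powersetCard N, ψ s • Pi.single s (1 : ℂ) := by
      calc ψ = ∑ s : Finset ι, ψ s • Pi.single s (1 : ℂ) := by
            conv_lhs => rw [← Finset.univ_sum_single ψ]
            refine Finset.sum_congr rfl fun s _ => ?_
            rw [← Pi.single_smul, smul_eq_mul, mul_one]
        _ = ∑ s ∈ (Finset.univ : Finset ι).powersetCard N, ψ s • Pi.single s (1 : ℂ) := by
            symm
            refine Finset.sum_subset (Finset.subset_univ _) fun s _ hs => ?_
            have hcard : s.card ≠ N := fun h =>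
              hs (Finset.mem_powersetCard.2 ⟨Finset.subset_univ _, h⟩)
            rw [hψ' s hcard, zero_smul]
    rw [hdecomp]
    refine Submodule.sum_mem _ fun s hs => Submodule.smul_mem _ _ (Submodule.subset_span ?_)
    rw [hS, Finset.coe_image]
    exact Set.mem_image_of_mem _ (Finset.mem_coe.2 hs)
  calc Module.finrank ℂ (nParticleSubmodule (ι := ι) N)
      ≤ Module.finrank ℂ (Submodule.span ℂ (S : Set (Fock ι))) := Submodule.finrank_mono hle
    _ ≤ S.card := finrank_span_finset_le_card S
    _ ≤ ((Finset.univ : Finset ι).powersetCard N).card := Finset.card_image_le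
    _ = (Fintype.card ι).choose N := by rw [Finset.card_powersetCard, Finset.card_univ]

/-! ### The sharp probabilistic normal form of the defect -/

section Sector

variable (L : ℕ) [NeZero L]

omit [NeZero L] in
/-- An occupation-basis vector `|s⟩` with `|s| = N` lies in the `N`-particle sector. [folklore] -/
private theorem sse_single_mem_nParticleSubmodule {N : ℕ} {s : Finset (Orb (FermionTorus 2 L))}
    (hs : s.card = N) :
    (Pi.single s (1 : ℂ) : Fock (Orb (FermionTorus 2 L))) ∈
      nParticleSubmodule (ι := Orb (FermionTorus 2 L)) N := by
  intro t ht
  exact Pi.single_eq_of_ne (fun h => ht (by rw [h]; exact hs)) _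

omit [NeZero L] in
/-- The orthogonal projection onto `nParticleSubmodule N` is the diagonal indicator of `|s| = N`. [folklore] -/
private theorem sse_projMatrix_nParticleSubmodule (N : ℕ) :
    projMatrix ((nParticleSubmodule (ι := Orb (FermionTorus 2 L)) N).map
        ((WithLp.linearEquiv 2 ℂ (Finset (Orb (FermionTorus 2 L)) → ℂ)).symm :
          (Finset (Orb (FermionTorus 2 L)) → ℂ) →ₗ[ℂ]
            EuclideanSpace ℂ (Finset (Orb (FermionTorus 2 L))))) =
      diagonal (fun s : Finset (Orb (FermionTorus 2 L)) => if s.card = N then (1 : ℂ) else 0) := by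
  refine Matrix.ext_of_mulVec_single fun t => ?_
  rw [diagonal_mulVec_single, mul_one]
  by_cases ht : t.card = N
  · rw [projMatrix_map_mulVec_of_mem _ (sse_single_mem_nParticleSubmodule L ht), if_pos ht]
  · rw [projMatrix_map_mulVec_eq_zero_of_orthogonal _ fun w hw => ?_, if_neg ht, Pi.single_zero]
    have hw' : IsNParticle N w := hw
    rw [dotProduct_single, mul_one, Pi.star_apply, hw' t ht, star_zero]

/-- `K_L(μ)` commutes with every diagonal function of the particle number `|s|`. [folklore] -/
private theorem sse_diagonal_card_mul_seededGC (U μ g : ℝ) (f : ℕ → ℂ) :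
    diagonal (fun s : Finset (Orb (FermionTorus 2 L)) => f s.card) *
        (hubbardTorusWith 2 L 1 U μ - ((g / (L : ℝ) ^ 2 : ℝ) : ℂ) •
          ((pairField dWaveFormFactor L)ᴴ * pairField dWaveFormFactor L)) =
      (hubbardTorusWith 2 L 1 U μ - ((g / (L : ℝ) ^ 2 : ℝ) : ℂ) •
          ((pairField dWaveFormFactor L)ᴴ * pairField dWaveFormFactor L)) *
        diagonal (fun s : Finset (Orb (FermionTorus 2 L)) => f s.card) := by
  ext s s'
  rw [diagonal_mul, mul_diagonal]
  by_cases h : (hubbardTorusWith 2 L 1 U μ - ((g / (L : ℝ) ^ 2 : ℝ) : ℂ) •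
      ((pairField dWaveFormFactor L)ᴴ * pairField dWaveFormFactor L)) s s' = 0
  · rw [h, mul_zero, zero_mul]
  · obtain ⟨h1, h2⟩ := tw_preservesSectors_seededGC L U μ g s s' h
    rw [card_eq_upPart_add_downPart s, card_eq_upPart_add_downPart s', h1, h2, mul_comm]

/-- **(d♯) The SHARP probabilistic normal form of the defect** on the even sectors `N = 2n ≤ 2L²`:
`β(E_V − μN) + log Re Z ≤ log C(2L², N) + log (Re Z / W_L(N; β, μ))`, `E_V = minEnergyOn Hcan (szSector N 0)`
— `stub_sectorWeightBasics` (d) with the sector dimension `C(2L², N)` in place of `|Fock| = 4^{L²}`.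
(`Re tr (P_N e^{−βK}) ≤ dim · e^{−β minEnergyOn K}` on the `K`-invariant sector, the Rayleigh shift by `μN`,
`stub_evenSectorMin`/`stub_pairFieldSinglet`, and `finrank_nParticleSubmodule_le_choose`.) [folklore] -/
theorem sharp_defect_normalForm (U g : ℝ) {β : ℝ} (hβ : 0 < β) (μ : ℝ) {n : ℕ} (hn : n ≤ L ^ 2) :
    β * ((hubbardTorus 2 L 1 U - ((g / (L : ℝ) ^ 2 : ℝ) : ℂ) •
          ((pairField dWaveFormFactor L)ᴴ * pairField dWaveFormFactor L)).minEnergyOn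
            (szSector (Λ := FermionTorus 2 L) (2 * n) 0) - μ * ((2 * n : ℕ) : ℝ)) +
      Real.log (Matrix.partitionFn β (hubbardTorusWith 2 L 1 U μ - ((g / (L : ℝ) ^ 2 : ℝ) : ℂ) •
        ((pairField dWaveFormFactor L)ᴴ * pairField dWaveFormFactor L))).re ≤
    Real.log ((2 * L ^ 2).choose (2 * n)) +
      Real.log ((Matrix.partitionFn β (hubbardTorusWith 2 L 1 U μ - ((g / (L : ℝ) ^ 2 : ℝ) : ℂ) •
          ((pairField dWaveFormFactor L)ᴴ * pairField dWaveFormFactor L))).re /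
        ∑ s ∈ (Finset.univ.filter fun s : Finset (Orb (FermionTorus 2 L)) => s.card = 2 * n),
          (Matrix.gibbsWeight β (hubbardTorusWith 2 L 1 U μ - ((g / (L : ℝ) ^ 2 : ℝ) : ℂ) •
            ((pairField dWaveFormFactor L)ᴴ * pairField dWaveFormFactor L)) s s).re) := by
  set K := hubbardTorusWith 2 L 1 U μ - ((g / (L : ℝ) ^ 2 : ℝ) : ℂ) •
    ((pairField dWaveFormFactor L)ᴴ * pairField dWaveFormFactor L) with hKdef
  set Hc := hubbardTorus 2 L 1 U - ((g / (L : ℝ) ^ 2 : ℝ) : ℂ) •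
    ((pairField dWaveFormFactor L)ᴴ * pairField dWaveFormFactor L) with hHcdef
  set V : Submodule ℂ (Fock (Orb (FermionTorus 2 L))) :=
    nParticleSubmodule (ι := Orb (FermionTorus 2 L)) (2 * n) with hVdef
  have h2n : 2 * n ≤ 2 * L ^ 2 := by omega
  have hKh : K.IsHermitian := tw_isHermitian_seededGC L U μ g
  have hHc : Hc.IsHermitian :=
    Summit.HubbardSuperconductivity.TwTipContinuation.Negative.seededH_isHermitian U g L
  -- `K = Hc − μN̂`, `[K, N̂] = 0`
  have heq : K = Hc - (μ : ℂ) • totalNumber := by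
    rw [hKdef, hHcdef, hubbardTorusWith_eq]
    abel
  have hKN : totalNumber * K = K * totalNumber := by
    rw [totalNumber_torus_eq_diagonal]
    exact sse_diagonal_card_mul_seededGC L U μ g (fun k => (k : ℂ))
  have hinv : ∀ v ∈ V, K *ᵥ v ∈ V := fun v hv =>
    LiebTwo.isNParticle_mulVec_of_commute (N := 2 * n) hv hKN
  -- the sector weight is the trace against the sector projection
  have hW : ((projMatrix (V.map ((WithLp.linearEquiv 2 ℂ (Finset (Orb (FermionTorus 2 L)) → ℂ)).symm :
      (Finset (Orb (FermionTorus 2 L)) → ℂ) →ₗ[ℂ] EuclideanSpace ℂ (Finset (Orb (FermionTorus 2 L))))) *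
        gibbsWeight β K).trace).re =
      ∑ s ∈ (Finset.univ.filter fun s : Finset (Orb (FermionTorus 2 L)) => s.card = 2 * n),
        (Matrix.gibbsWeight β K s s).re := by
    rw [hVdef, sse_projMatrix_nParticleSubmodule L (2 * n), Matrix.trace, Complex.re_sum, Finset.sum_filter]
    refine Finset.sum_congr rfl fun s _ => ?_
    simp only [Matrix.diag_apply, diagonal_mul, ite_mul, one_mul, zero_mul]
    split_ifs <;> simp
  have hle := re_trace_projMatrix_mul_gibbsWeight_le hKh V hinv hβ.le
  rw [hW] at hle
  -- the grand-canonical sector energy is the canonical one shifted by `μ·2n`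
  have hmin : Hc.minEnergyOn (szSector (Λ := FermionTorus 2 L) (2 * n) 0) - μ * ((2 * n : ℕ) : ℝ) ≤
      K.minEnergyOn V := by
    rw [hHcdef, stub_evenSectorMin stub_pairFieldSinglet L U g (2 * n) (even_two_mul n) h2n, ← hHcdef]
    obtain ⟨s₀, -, hs₀⟩ := Finset.exists_subset_card_eq
      (s := (Finset.univ : Finset (Orb (FermionTorus 2 L)))) (n := 2 * n)
      (by rwa [Finset.card_univ, card_orb_fermionTorus_two])
    have hunit₀ : star (Pi.single s₀ (1 : ℂ) : Fock (Orb (FermionTorus 2 L))) ⬝ᵥ Pi.single s₀ 1 = 1 := by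
      rw [← Pi.single_star, star_one, single_dotProduct, one_mul, Pi.single_eq_same]
    refine le_csInf ⟨_, _, sse_single_mem_nParticleSubmodule L hs₀, hunit₀, rfl⟩ ?_
    rintro E ⟨ψ, hψV, hψ1, rfl⟩
    have hN : IsNParticle (2 * n) ψ := hψV
    have hshift : (star ψ ⬝ᵥ K *ᵥ ψ).re = (star ψ ⬝ᵥ Hc *ᵥ ψ).re - μ * ((2 * n : ℕ) : ℝ) := by
      rw [heq, sub_mulVec, smul_mulVec, totalNumber_mulVec_of_isNParticle hN, smul_smul,
        dotProduct_sub, dotProduct_smul, hψ1, Complex.sub_re]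
      simp
    rw [hshift]
    have h := minEnergyOn_le_rayleigh_of_mem hHc V hψV hψ1
    linarith
  -- `dim V ≤ C(2L², 2n)`
  have hdim : (Module.finrank ℂ V : ℝ) ≤ ((2 * L ^ 2).choose (2 * n) : ℝ) := by
    have h := finrank_nParticleSubmodule_le_choose (ι := Orb (FermionTorus 2 L)) (2 * n)
    rw [card_orb_fermionTorus_two] at h
    exact_mod_cast h
  have hchoose : (0 : ℝ) < ((2 * L ^ 2).choose (2 * n) : ℝ) := by exact_mod_cast Nat.choose_pos h2n
  -- positivity of `W` and `Z`
  obtain ⟨-, -, hposW, -⟩ := stub_sectorWeightBasics L U g β hβ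
  have hWpos := hposW μ (2 * n) h2n
  have hZpos : 0 < (Matrix.partitionFn β K).re :=
    lt_of_lt_of_le (Real.exp_pos _) (exp_neg_mul_groundEnergy_le_partitionFn hKh β)
  -- logarithms
  have hlogW : Real.log (∑ s ∈ (Finset.univ.filter fun s : Finset (Orb (FermionTorus 2 L)) => s.card = 2 * n),
      (Matrix.gibbsWeight β K s s).re) ≤
      Real.log ((2 * L ^ 2).choose (2 * n)) + -(β * K.minEnergyOn V) := by
    have hWC := hle.trans (mul_le_mul_of_nonneg_right hdim (Real.exp_pos _).le)
    have h := Real.log_le_log hWpos hWC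
    rwa [Real.log_mul hchoose.ne' (Real.exp_pos _).ne', Real.log_exp] at h
  have hβm : β * (Hc.minEnergyOn (szSector (Λ := FermionTorus 2 L) (2 * n) 0) - μ * ((2 * n : ℕ) : ℝ)) ≤
      β * K.minEnergyOn V := mul_le_mul_of_nonneg_left hmin hβ.le
  rw [Real.log_div hZpos.ne' hWpos.ne']
  linarith

end Sector

/-! ### Entropy arithmetic -/

/-- **Binomial entropy bound**: `log C(m, k) ≤ m · h(k/m)` (`h = Real.binEntropy`, nats), `k ≤ m`. [folklore] -/
theorem log_choose_le_mul_binEntropy {m k : ℕ} (hkm : k ≤ m) :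
    Real.log (m.choose k) ≤ (m : ℝ) * Real.binEntropy ((k : ℝ) / m) := by
  rcases Nat.eq_zero_or_pos m with rfl | hm
  · have hk : k = 0 := Nat.le_zero.mp hkm
    subst hk
    simp
  have hmR : (0 : ℝ) < m := by exact_mod_cast hm
  have h := Literature.Analysis.SpecialFunctions.log_choose_le_entropy hkm
  -- `m h(k/m) = m log m − k log k − (m − k) log (m − k)`
  have hid : (m : ℝ) * Real.binEntropy ((k : ℝ) / m) =
      m * Real.log m - k * Real.log k - (m - k : ℝ) * Real.log (m - k : ℝ) := by
    rw [Real.binEntropy_eq_negMulLog_add_negMulLog_one_sub, Real.negMulLog, Real.negMulLog]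
    have h1 : (1 : ℝ) - k / m = (m - k) / m := by field_simp
    rw [h1]
    rcases Nat.eq_zero_or_pos k with rfl | hk
    · simp
    have hkR : (0 : ℝ) < k := by exact_mod_cast hk
    rcases eq_or_lt_of_le hkm with rfl | hlt
    · simp
    have hmk : (0 : ℝ) < (m : ℝ) - k := by
      have : (k : ℝ) < m := by exact_mod_cast hlt
      linarith
    rw [Real.log_div hkR.ne' hmR.ne', Real.log_div hmk.ne' hmR.ne']
    field_simp
    ring
  rw [hid]
  exact h

/-- **The sector entropy at the crux's particle number**: for `0 ≤ δ ≤ 1`,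
`log C(2L², 2⌊(1−δ)L²/2⌋) ≤ 2L² · h((1−δ)/2)` (the filling fraction `N_L/(2L²) ≤ (1−δ)/2 ≤ 1/2` and `h` is
increasing on `[0, 1/2]`). [folklore] -/
theorem log_choose_sector_le (L : ℕ) {δ : ℝ} (hδ0 : 0 ≤ δ) (hδ1 : δ ≤ 1) :
    Real.log ((2 * L ^ 2).choose (2 * ⌊(1 - δ) * (L : ℝ) ^ 2 / 2⌋₊)) ≤
      2 * (L : ℝ) ^ 2 * Real.binEntropy ((1 - δ) / 2) := by
  rcases Nat.eq_zero_or_pos L with rfl | hL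
  · simp
  have hLR : (0 : ℝ) < L := by exact_mod_cast hL
  have hL2 : (0 : ℝ) < (L : ℝ) ^ 2 := by positivity
  set N : ℕ := 2 * ⌊(1 - δ) * (L : ℝ) ^ 2 / 2⌋₊ with hNdef
  have hfl : (⌊(1 - δ) * (L : ℝ) ^ 2 / 2⌋₊ : ℝ) ≤ (1 - δ) * (L : ℝ) ^ 2 / 2 :=
    Nat.floor_le (by have : 0 ≤ 1 - δ := by linarith
                     positivity)
  have hNle : (N : ℝ) ≤ (1 - δ) * (L : ℝ) ^ 2 := by
    rw [hNdef]; push_cast; linarith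
  have hNnat : N ≤ 2 * L ^ 2 := by
    have h1 : (N : ℝ) ≤ ((2 * L ^ 2 : ℕ) : ℝ) := by
      push_cast
      have : (1 - δ) * (L : ℝ) ^ 2 ≤ 2 * (L : ℝ) ^ 2 := by nlinarith
      linarith
    exact_mod_cast h1
  have h := log_choose_le_mul_binEntropy hNnat
  have hm : ((2 * L ^ 2 : ℕ) : ℝ) = 2 * (L : ℝ) ^ 2 := by push_cast; ring
  rw [hm] at h
  refine h.trans (mul_le_mul_of_nonneg_left ?_ (by positivity))
  -- monotonicity of `h` on `[0, 1/2]`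
  have hp0 : 0 ≤ (N : ℝ) / (2 * (L : ℝ) ^ 2) := by positivity
  have hp : (N : ℝ) / (2 * (L : ℝ) ^ 2) ≤ (1 - δ) / 2 := by
    rw [div_le_div_iff₀ (by positivity) (by norm_num)]
    nlinarith
  have hq : (1 - δ) / 2 ≤ 2⁻¹ := by
    rw [inv_eq_one_div]
    exact div_le_div_of_nonneg_right (by linarith) (by norm_num)
  have hq0 : 0 ≤ (1 - δ) / 2 := by
    have : 0 ≤ 1 - δ := by linarith
    positivity
  exact Real.binEntropy_strictMonoOn.monotoneOn ⟨hp0, hp.trans hq⟩ ⟨hq0, hq⟩ hp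

/-- **The entropy slack of the crux is positive**: `0 < log 4 − 2 h((1−δ)/2)` for `0 < δ ≤ 1`
(`h(p) < log 2` for `p ≠ 1/2`). On `δ ∈ [1/10, 2/5]` it ranges in `[0.0100, 0.165]`. [folklore] -/
theorem entropySlack_pos {δ : ℝ} (hδ0 : 0 < δ) (_hδ1 : δ ≤ 1) :
    0 < Real.log 4 - 2 * Real.binEntropy ((1 - δ) / 2) := by
  have hne : (1 - δ) / 2 ≠ 2⁻¹ := by
    intro h
    have : (1 - δ) = 1 := by
      have := congrArg (· * 2) h
      simp at this
      linarith
    linarith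
  have hlt := Real.binEntropy_lt_log_two.2 hne
  have h4 : Real.log 4 = 2 * Real.log 2 := by
    rw [show (4 : ℝ) = 2 ^ 2 by norm_num, Real.log_pow]; norm_num
  rw [h4]
  linarith

/-! ### Registered form -/

/-- **Registered stub `hw_sharpDefectNormalForm` (line `Sketch`, crux stmt-HubbardSuperconductivity-15581): the sharp
probabilistic normal form (d♯) in binder-free, fully qualified form** (= `sharp_defect_normalForm`). [folklore] -/
theorem hw_sharpDefectNormalForm : ∀ (L : ℕ) [NeZero L] (U g β μ : ℝ) (n : ℕ), 0 < β → n ≤ L ^ 2 → β * ((Literature.MathematicalPhysics.QuantumLattice.hubbardTorus 2 L 1 U - ((g / (L : ℝ) ^ 2 : ℝ) : ℂ) • ((Literature.MathematicalPhysics.QuantumLattice.pairField Literature.MathematicalPhysics.QuantumLattice.dWaveFormFactor L)ᴴ * Literature.MathematicalPhysics.QuantumLattice.pairField Literature.MathematicalPhysics.QuantumLattice.dWaveFormFactor L)).minEnergyOn (Literature.MathematicalPhysics.QuantumLattice.szSector (Λ := Literature.MathematicalPhysics.QuantumLattice.FermionTorus 2 L) (2 * n) 0) - μ * ((2 * n :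 ℕ) : ℝ)) + Real.log (Matrix.partitionFn β (Literature.MathematicalPhysics.QuantumLattice.hubbardTorusWith 2 L 1 U μ - ((g / (L : ℝ) ^ 2 : ℝ) : ℂ) • ((Literature.MathematicalPhysics.QuantumLattice.pairField Literature.MathematicalPhysics.QuantumLattice.dWaveFormFactor L)ᴴ * Literature.MathematicalPhysics.QuantumLattice.pairField Literature.MathematicalPhysics.QuantumLattice.dWaveFormFactor L))).re ≤ Real.log ((2 * L ^ 2).choose (2 * n)) + Real.log ((Matrix.partitionFn β (Literature.MathematicalPhysics.QuantumLattice.hubbardTorusWith 2 L 1 U μ - ((g / (L : ℝ) ^ 2 : ℝ) : ℂ) • ((Literature.MathematicalPhysics.QuantumLattice.pairField Literature.MathematicalPhysics.QuantumLattice.dWaveFormFactor L)ᴴ * Literature.MathematicalPhysics.QuantumLattice.pairField Literature.MathematicalPhysics.QuantumLattice.dWaveFormFactor L))).re / ∑ s ∈ (Finset.univ.filter fun s : Finset (Literature.MathematicalPhysics.QuantumLattice.Orb (Literature.MathematicalPhysics.QuantumLattice.FermionTorus 2 L)) => s.card = 2 * n), (Matrix.gibbsWeight β (Literature.MathematicalPhysics.QuantumLattice.hubbardTorusWith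 2 L 1 U μ - ((g / (L : ℝ) ^ 2 : ℝ) : ℂ) • ((Literature.MathematicalPhysics.QuantumLattice.pairField Literature.MathematicalPhysics.QuantumLattice.dWaveFormFactor L)ᴴ * Literature.MathematicalPhysics.QuantumLattice.pairField Literature.MathematicalPhysics.QuantumLattice.dWaveFormFactor L)) s s).re) :=
  fun L _ U g _ μ _ hβ hn => sharp_defect_normalForm L U g hβ μ hn

end

end Summit.HubbardSuperconductivity.HubbardSuperconductivity.Theorems.TwSeededEnsembleEquivalenceR.HotWindow
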